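import Literature.NumberTheory.LFunctions.BurnolZetaSystemsDuality
import HarnessLib

/-!
# Burnol 2004b, Thm. 3.3 (ii): the zeta-quotient system `ζ(s)/(s−ρ)^l` is minimal in `L_1`

LINE 1 — LABEL: RH-FREE (minimality of a fixed system of vectors of Burnol's space `L_1`, indexed by
the non-trivial zeros of `ζ` WHEREVER they lie). FRAMING (cell rh-crit, D-0074): corpus theorems are
RH-FREE literature; nothing here is worded as progress toward RH. bears_on: B-C/B-P (LADDER-RH
COLUMN 6, de Branges framework) as clause (ii) of [Burnol2004b, Thm. 3.3] (`Burnol2004b_thm3_3`).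
WHAT THIS IS NOT: not a route, not a criterion; nothing here bears on the truth of RH.

Source: J.-F. Burnol, JTNB 16 (2004) = arXiv:math/0203120v7, Thm. 3.3 and the paragraph before it,
TeX of record `dbl/src/Burnol2004JTNB_arXivmath0203120v7.tex` l.566–594: "So the system of the
`ζ(s)/(s−ρ)^l` is minimal in `L̂_1`, with a dual system given by triangular combinations of the
evaluators `Y¹_{ρ,k}`" — from the triangular duality `[v_{ρ,l}, Y¹_{ρ′,k}] = 0` for `ρ′ ≠ ρ` or
`k + l < m_ρ`, `≠ 0` for `k + l = m_ρ` (clauses (iv)–(vi), `BurnolZetaSystemsDuality.lean`).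

## What is proved (theorems only; no definition, no named fact)

* `BurnolZetaMinimal.exists_pairingCLM` — `f ↦ [f, Y] = ∫₀^∞ fY` is a continuous linear functional
  on `L²(ℝ)`;
* `BurnolZetaMinimal.pairing_vector_eq_iteratedDeriv` — `[v_{ρ,l}, Y¹_{ρ′,k}]` for all admissible
  `ρ, l, ρ′, k` (not only system indices);
* `BurnolZetaMinimal.exists_dual_functional` — the triangular inversion: for each `(ρ, l₀)` a finite
  combination `ψ` of the `[·, Y¹_{ρ,k}]`, `k < m_ρ`, with `ψ(v_{ρ,l}) = 0` (`l ≠ l₀`), `ψ(v_{ρ,l₀}) ≠ 0`,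
  killing every vector killed by all the `[·, Y¹_{ρ,k}]`;
* **`Burnol2004b_thm3_3_ii : IsMinimalSystem zetaQuotientSystem`** — conjunct 2 of
  `Burnol2004b_thm3_3`, verbatim and hypothesis-free;
* `Burnol2004b_thm3_3_of_cor5_3 : Burnol2004b_cor5_3 → Burnol2004b_thm3_3` — the typed Thm. 3.3 is
  now exactly its completeness clause (Cor. 5.3) away (the converse `Burnol2004b_cor5_3_of_thm3_3`
  is in `BurnolZetaSystemsProofs.lean`).

## References

* J.-F. Burnol, JTNB 16 (2004), Thm. 3.3 (arXiv:math/0203120v7 p. 7, TeX l.566–594). [key `Burnol2004b`]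
-/

noncomputable section

open MeasureTheory Complex Filter Set Real
open scoped Topology ComplexConjugate InnerProductSpace

namespace Literature.NumberTheory.LFunctions

namespace BurnolZetaMinimal

open BurnolZetaHardy BurnolEvaluators BurnolZetaDuality

/-! ## A. The triangular inversion (generic) -/

/-- **Triangular inversion.** Functionals `φ_k` and vectors `v_l` (`1 ≤ l ≤ m`) with `φ_k(v_l) = 0`
for `k + l < m` and `φ_k(v_l) ≠ 0` for `k + l = m` admit, for each `l₀`, a finite combination `ψ` of
the `φ_k` (`k < m`) with `ψ(v_{l₀}) ≠ 0`, `ψ(v_l) = 0` for `l ≠ l₀`, and `ψ` killing the common kernel of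
the `φ_k`, `k < m` ("triangular linear combinations", downward induction on `l₀`).
[cite: Burnol2004b, Thm. 3.3 (arXiv:math/0203120v7 p. 7, TeX l.574–578, 587–594)] -/
theorem exists_dual_functional {E : Type*} [AddCommGroup E] [Module ℂ E] [TopologicalSpace E]
    (φ : ℕ → E →L[ℂ] ℂ) (v : ℕ → E) (m : ℕ)
    (h0 : ∀ k l, 1 ≤ l → l ≤ m → k + l < m → φ k (v l) = 0)
    (h1 : ∀ k l, 1 ≤ l → l ≤ m → k + l = m → φ k (v l) ≠ 0) :
    ∀ l₀, 1 ≤ l₀ → l₀ ≤ m → ∃ ψ : E →L[ℂ] ℂ, ψ (v l₀) ≠ 0 ∧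
      (∀ l, 1 ≤ l → l ≤ m → l ≠ l₀ → ψ (v l) = 0) ∧ ∀ x, (∀ k, k < m → φ k x = 0) → ψ x = 0 := by
  -- downward induction on `l₀`, measured by `d = m - l₀`
  suffices H : ∀ d l₀, m - l₀ = d → 1 ≤ l₀ → l₀ ≤ m → ∃ ψ : E →L[ℂ] ℂ, ψ (v l₀) ≠ 0 ∧
      (∀ l, 1 ≤ l → l ≤ m → l ≠ l₀ → ψ (v l) = 0) ∧ ∀ x, (∀ k, k < m → φ k x = 0) → ψ x = 0 from
    fun l₀ h1' h2' ↦ H (m - l₀) l₀ rfl h1' h2'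
  intro d
  induction d using Nat.strong_induction_on with
  | _ d IH =>
    intro l₀ hd hl₀ hl₀m
    -- the already constructed dual functionals for `l₀ < l ≤ m`
    have IH' : ∀ l, l₀ < l → l ≤ m → ∃ ψ : E →L[ℂ] ℂ, ψ (v l) ≠ 0 ∧
        (∀ l', 1 ≤ l' → l' ≤ m → l' ≠ l → ψ (v l') = 0) ∧ ∀ x, (∀ k, k < m → φ k x = 0) → ψ x = 0 :=
      fun l hl hlm ↦ IH (m - l) (by omega) l rfl (by omega) hlm
    choose! Ψ hΨ0 hΨ1 hΨ2 using IH'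
    set k₀ := m - l₀ with hk₀
    refine ⟨φ k₀ - ∑ l ∈ Finset.Ioc l₀ m, (φ k₀ (v l) / Ψ l (v l)) • Ψ l, ?_, ?_, ?_⟩
    · -- at `v l₀`: the correction terms vanish, `φ_{k₀}(v_{l₀}) ≠ 0`
      have hsum : (∑ l ∈ Finset.Ioc l₀ m, (φ k₀ (v l) / Ψ l (v l)) • Ψ l) (v l₀) = 0 := by
        rw [sum_apply]
        refine Finset.sum_eq_zero fun l hl ↦ ?_
        rw [Finset.mem_Ioc] at hl
        rw [smul_apply, hΨ1 l hl.1 hl.2 l₀ hl₀ hl₀m (by omega), smul_zero]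
      rw [sub_apply, hsum, sub_zero]
      exact h1 k₀ l₀ hl₀ hl₀m (by omega)
    · intro l hl hlm hne
      rcases lt_or_gt_of_ne hne with hlt | hgt
      · -- `l < l₀`: every term vanishes
        have hsum : (∑ l' ∈ Finset.Ioc l₀ m, (φ k₀ (v l') / Ψ l' (v l')) • Ψ l') (v l) = 0 := by
          rw [sum_apply]
          refine Finset.sum_eq_zero fun l' hl' ↦ ?_
          rw [Finset.mem_Ioc] at hl'
          rw [smul_apply, hΨ1 l' hl'.1 hl'.2 l hl hlm (by omega), smul_zero]
        rw [sub_apply, hsum, sub_zero]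
        exact h0 k₀ l hl hlm (by omega)
      · -- `l₀ < l`: the `l`-th correction cancels `φ_{k₀}(v_l)`, the others vanish
        have hsum : (∑ l' ∈ Finset.Ioc l₀ m, (φ k₀ (v l') / Ψ l' (v l')) • Ψ l') (v l) =
            φ k₀ (v l) := by
          rw [sum_apply, Finset.sum_eq_single_of_mem l
            (Finset.mem_Ioc.2 ⟨hgt, hlm⟩)]
          · rw [smul_apply, smul_eq_mul, div_mul_cancel₀ _ (hΨ0 l hgt hlm)]
          · intro l' hl' hl'ne
            rw [Finset.mem_Ioc] at hl'
            rw [smul_apply, hΨ1 l' hl'.1 hl'.2 l hl hlm (Ne.symm hl'ne), smul_zero]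
        rw [sub_apply, hsum, sub_self]
    · intro x hx
      have hsum : (∑ l ∈ Finset.Ioc l₀ m, (φ k₀ (v l) / Ψ l (v l)) • Ψ l) x = 0 := by
        rw [sum_apply]
        refine Finset.sum_eq_zero fun l hl ↦ ?_
        rw [Finset.mem_Ioc] at hl
        rw [smul_apply, hΨ2 l hl.1 hl.2 x hx, smul_zero]
      rw [sub_apply, hsum, sub_zero]
      exact hx k₀ (by omega)

/-! ## B. The pairing `f ↦ [f, Y]` is a continuous linear functional -/

/-- **`f ↦ [f, Y] = ∫₀^∞ f·Y` is a continuous linear functional on `L²(ℝ)`** (it is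
`⟪(conj Y)|_{(0,∞)}, f|_{(0,∞)}⟫` in `L²(0,∞)`). [cite: Burnol2004b, §2 (arXiv:math/0203120v7 p. 5, TeX l.477–481)] -/
theorem exists_pairingCLM (Y : Lp ℂ 2 (volume : Measure ℝ)) :
    ∃ T : Lp ℂ 2 (volume : Measure ℝ) →L[ℂ] ℂ,
      ∀ f : Lp ℂ 2 (volume : Measure ℝ), T f = ∫ t in Ioi (0 : ℝ), f t * Y t := by
  set res := LpToLpRestrictCLM ℝ ℂ ℂ (volume : Measure ℝ) 2 (Ioi (0 : ℝ)) with hres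
  set JY := ((((starₗᵢ ℂ : ℂ ≃ₗᵢ⋆[ℂ] ℂ).toContinuousLinearEquiv : ℂ →L⋆[ℂ] ℂ).compLpL 2
    (volume : Measure ℝ) Y : Lp ℂ 2 (volume : Measure ℝ))) with hJY
  refine ⟨(innerSL ℂ (res JY)).comp res, fun f ↦ ?_⟩
  rw [ContinuousLinearMap.comp_apply, innerSL_apply_apply, L2.inner_def]
  refine integral_congr_ae ?_
  have h1 := LpToLpRestrictCLM_coeFn ℂ (Ioi (0 : ℝ)) JY (p := 2) (μ := (volume : Measure ℝ))
  have h2 := LpToLpRestrictCLM_coeFn ℂ (Ioi (0 : ℝ)) f (p := 2) (μ := (volume : Measure ℝ))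
  have h3 := ae_restrict_of_ae (s := Ioi (0 : ℝ)) (Literature.Analysis.Fourier.coeFn_conjLp Y)
  filter_upwards [h1, h2, h3] with t ht1 ht2 ht3
  rw [RCLike.inner_apply', ht1, ht2, ht3, Complex.conj_conj, mul_comm]

/-! ## C. The pairing `[v_{ρ,l}, Y¹_{ρ′,k}]` for all admissible indices -/

/-- **`[v_{ρ,l}, Y¹_{ρ′,k}] = (d/ds)^k[Γ_ℝ(s)ζ(s)/(s−ρ)^l]_{s=ρ′}`** for non-trivial zeros `ρ, ρ′`,
`1 ≤ l ≤ m_ρ` and EVERY `k` (the evaluators `Y¹_{ρ′,k}` exist for all `k`).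
[cite: Burnol2004b, Thm. 3.3 (arXiv:math/0203120v7 p. 7, TeX l.566–578)] -/
theorem pairing_vector_eq_iteratedDeriv {ρ ρ' : ℂ} (hρ : ρ ∈ ZetaZeros.riemannZetaNontrivialZeros)
    {l : ℕ} (hl : 1 ≤ l) (hlm : (l : ℤ) ≤ riemannZetaZeroOrder ρ)
    (hρ' : ρ' ∈ ZetaZeros.riemannZetaNontrivialZeros) (k : ℕ) :
    ∫ t in Ioi (0 : ℝ), zetaQuotientVector ρ l t * burnolY 1 ρ' k t =
      iteratedDeriv k (fun s ↦ Gammaℝ s * zetaOverPow ρ l s) ρ' := by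
  obtain ⟨h0, h1, hn⟩ := admissible_of_mem_nontrivialZeros hρ'
  have hv := isZetaQuotientVector_zetaQuotientVector hρ hl hlm
  rw [(isBurnolY_burnolY one_pos h0 h1 hn k).2 _ hv.1]
  simp only [burnolEval]
  apply Filter.EventuallyEq.iteratedDeriv_eq
  filter_upwards [isOpen_ne.mem_nhds h1] with s hs
  simp only [completedMellin]
  rw [rightMellinExt_zetaQuotientVector hρ hl hlm hs]

/-- The pairing vanishes below the order at `ρ′ = ρ`: `k + l < m_ρ`. [cite: Burnol2004b, Thm. 3.3 (arXiv:math/0203120v7 p. 7, TeX l.566–578)] -/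
theorem pairing_vector_self_eq_zero {ρ : ℂ} (hρ : ρ ∈ ZetaZeros.riemannZetaNontrivialZeros) {l : ℕ}
    (hl : 1 ≤ l) (hlm : l ≤ (riemannZetaZeroOrder ρ).toNat) {k : ℕ}
    (hk : k + l < (riemannZetaZeroOrder ρ).toNat) :
    ∫ t in Ioi (0 : ℝ), zetaQuotientVector ρ l t * burnolY 1 ρ k t = 0 := by
  have hlm' : (l : ℤ) ≤ riemannZetaZeroOrder ρ := by omega
  rw [pairing_vector_eq_iteratedDeriv hρ hl hlm' hρ k]
  have hΛ := analyticAt_completedQuotient hρ hlm' hρ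
  have hord := analyticOrderAt_completedQuotient_self hρ hl hlm'
  exact (natCast_le_analyticOrderAt_iff_iteratedDeriv_eq_zero hΛ).1 hord.symm.le k (by omega)

/-- The pairing does not vanish at the order at `ρ′ = ρ`: `k + l = m_ρ`. [cite: Burnol2004b, Thm. 3.3 (arXiv:math/0203120v7 p. 7, TeX l.566–578)] -/
theorem pairing_vector_self_ne_zero {ρ : ℂ} (hρ : ρ ∈ ZetaZeros.riemannZetaNontrivialZeros) {l : ℕ}
    (hl : 1 ≤ l) (hlm : l ≤ (riemannZetaZeroOrder ρ).toNat) {k : ℕ}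
    (hk : k + l = (riemannZetaZeroOrder ρ).toNat) :
    ∫ t in Ioi (0 : ℝ), zetaQuotientVector ρ l t * burnolY 1 ρ k t ≠ 0 := by
  have hlm' : (l : ℤ) ≤ riemannZetaZeroOrder ρ := by omega
  rw [pairing_vector_eq_iteratedDeriv hρ hl hlm' hρ k]
  have hΛ := analyticAt_completedQuotient hρ hlm' hρ
  have hord := analyticOrderAt_completedQuotient_self hρ hl hlm'
  rw [show (riemannZetaZeroOrder ρ).toNat - l = k by omega] at hord
  exact ((analyticOrderAt_eq_nat_iff_iteratedDeriv_eq_zero hΛ).1 hord).2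

/-- The pairing vanishes at `ρ′ ≠ ρ` for `k < m_{ρ′}`. [cite: Burnol2004b, Thm. 3.3 (arXiv:math/0203120v7 p. 7, TeX l.566–578)] -/
theorem pairing_vector_of_ne_eq_zero {ρ ρ' : ℂ} (hρ : ρ ∈ ZetaZeros.riemannZetaNontrivialZeros)
    {l : ℕ} (hl : 1 ≤ l) (hlm : (l : ℤ) ≤ riemannZetaZeroOrder ρ)
    (hρ' : ρ' ∈ ZetaZeros.riemannZetaNontrivialZeros) (hne : ρ' ≠ ρ) {k : ℕ}
    (hk : k < (riemannZetaZeroOrder ρ').toNat) :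
    ∫ t in Ioi (0 : ℝ), zetaQuotientVector ρ l t * burnolY 1 ρ' k t = 0 := by
  rw [pairing_vector_eq_iteratedDeriv hρ hl hlm hρ' k]
  have hΛ := analyticAt_completedQuotient hρ hlm hρ'
  have hord := analyticOrderAt_completedQuotient_of_ne (l := l) hρ' hne
  exact (natCast_le_analyticOrderAt_iff_iteratedDeriv_eq_zero hΛ).1 hord.symm.le k hk

/-! ## D. Thm. 3.3 (ii): minimality -/

/-- **Thm. 3.3 (ii)** (conjunct 2 of `Burnol2004b_thm3_3`, verbatim): the system `(ζ(s)/(s−ρ)^l)`,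
`ρ` a non-trivial zero, `1 ≤ l ≤ m_ρ`, is MINIMAL in `L_1` — no `v_{ρ,l₀}` lies in the closed span of
the others: the dual functional `ψ` of the triangular inversion (a combination of the continuous
`[·, Y¹_{ρ,k}]`, `k < m_ρ`) kills every other vector of the system (same `ρ`: by construction; other
zeros `ρ″`: every `[v_{ρ″,l}, Y¹_{ρ,k}]`, `k < m_ρ`, vanishes) but not `v_{ρ,l₀}`.
[cite: Burnol2004b, Thm. 3.3 (arXiv:math/0203120v7 p. 7, TeX l.566–594)] -/
theorem Burnol2004b_thm3_3_ii : IsMinimalSystem zetaQuotientSystem := by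
  intro p₀ hmem
  obtain ⟨⟨ρ, k₀⟩, hρ, hk₀⟩ := p₀
  simp only at hρ hk₀ hmem
  set m := (riemannZetaZeroOrder ρ).toNat with hm
  have hl₀m : k₀ + 1 ≤ m := by omega
  -- the functionals `[·, Y¹_{ρ,k}]`
  choose T hT using fun k : ℕ ↦ exists_pairingCLM (burnolY 1 ρ k)
  have h0 : ∀ k l, 1 ≤ l → l ≤ m → k + l < m → T k (zetaQuotientVector ρ l) = 0 := by
    intro k l hl hlm hkl
    rw [hT]
    exact pairing_vector_self_eq_zero hρ hl hlm hkl
  have h1 : ∀ k l, 1 ≤ l → l ≤ m → k + l = m → T k (zetaQuotientVector ρ l) ≠ 0 := by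
    intro k l hl hlm hkl
    rw [hT]
    exact pairing_vector_self_ne_zero hρ hl hlm hkl
  obtain ⟨ψ, hψ0, hψ1, hψ2⟩ :=
    exists_dual_functional T (fun l ↦ zetaQuotientVector ρ l) m h0 h1 (k₀ + 1) (by omega) hl₀m
  -- `ψ` kills every other vector of the system
  have hker : ∀ r : ZetaZeroIndex, r ≠ ⟨(ρ, k₀), hρ, hk₀⟩ → ψ (zetaQuotientSystem r) = 0 := by
    intro r hr
    obtain ⟨⟨ρr, kr⟩, hρr, hkr⟩ := r
    show ψ (zetaQuotientVector ρr (kr + 1)) = 0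
    by_cases heq : ρr = ρ
    · subst heq
      have hne : kr + 1 ≠ k₀ + 1 := by
        intro h
        apply hr
        have : kr = k₀ := by omega
        subst this
        rfl
      exact hψ1 (kr + 1) (by omega) (by simp only at hkr; omega) hne
    · refine hψ2 _ fun k hk ↦ ?_
      rw [hT]
      exact pairing_vector_of_ne_eq_zero hρr (by omega) (by simp only at hkr; push_cast; omega) hρ
        (Ne.symm heq) hk
  -- the closed span of the others lies in `ker ψ`
  have hspan : (Submodule.span ℂ (zetaQuotientSystem '' {j | j ≠ ⟨(ρ, k₀), hρ, hk₀⟩}) :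
      Set (Lp ℂ 2 (volume : Measure ℝ))) ⊆ {x | ψ x = 0} := by
    have : Submodule.span ℂ (zetaQuotientSystem '' {j | j ≠ ⟨(ρ, k₀), hρ, hk₀⟩}) ≤
        LinearMap.ker (ψ : Lp ℂ 2 (volume : Measure ℝ) →ₗ[ℂ] ℂ) := by
      refine Submodule.span_le.2 ?_
      rintro x ⟨r, hr, rfl⟩
      exact hker r hr
    intro x hx
    exact this hx
  have hcl : closure (Submodule.span ℂ (zetaQuotientSystem '' {j | j ≠ ⟨(ρ, k₀), hρ, hk₀⟩}) :
      Set (Lp ℂ 2 (volume : Measure ℝ))) ⊆ {x | ψ x = 0} :=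
    closure_minimal hspan (isClosed_singleton.preimage ψ.continuous)
  exact hψ0 (hcl hmem)

/-! ## E. Thm. 3.3 assembled modulo its completeness clause (Cor. 5.3) -/

/-- **Thm. 3.3 from Cor. 5.3**: with clauses (i) (`Burnol2004b_thm3_3_i`), (ii) (`Burnol2004b_thm3_3_ii`),
(iv)–(vi) (`Burnol2004b_thm3_3_iv/_v/_vi`) proved, the full typed Thm. 3.3 is EXACTLY its completeness
clause (iii) = Cor. 5.3 (`Burnol2004b_cor5_3`, itself Thm. 5.2 + Thm. 4.9 + Prop. 4.2 in print) away.
[cite: Burnol2004b, Thm. 3.3 and Cor. 5.3 (arXiv:math/0203120v7 pp. 7, 14; TeX l.587–594, 1124–1127)] -/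
theorem Burnol2004b_thm3_3_of_cor5_3 (h : Burnol2004b_cor5_3) : Burnol2004b_thm3_3 :=
  ⟨Burnol2004b_thm3_3_i, Burnol2004b_thm3_3_ii, h, Burnol2004b_thm3_3_iv, Burnol2004b_thm3_3_v,
    Burnol2004b_thm3_3_vi⟩

end BurnolZetaMinimal

end Literature.NumberTheory.LFunctions

end
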